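import Summits.Ventures.FusionMHD.Bench.SAlphaEnclosureChecks1
import HarnessLib

/-!
# F3 — `s–α` at `(s, α) = (1, 2/5)`: even-solution enclosure transcript, KERNEL CHECK FILE 2/3 (stages 17–33: HOE step test ∧ landing,
# one `decide` per stage, ≈ 5 kernel-s each)
(venture LADDER-GRIDFUSION, rung F3, «#199-cand … PATH W» of gridfusion-lead RULING 9ez (6): «lit-3 socket `not_unstableWitness_of_clockField` +
enclosure + a gridfusion `EChainCert` `check = true` in kernel»; cell `gridfusion`, typed by gridfusion-lit-3 (g13), 2026-08-28; generator =
lit-3's untrusted Lean-interpreter search `scratch/GenSAlphaChain51g.lean` (Taylor tube + padding `2·10⁻²`, a-priori grid `10⁻⁴`, hand-over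
grid `10⁻⁷`); 0 `def … : Prop` facts, 0 kit jobs, no `native_decide`, no floating point.)

-/

open NonemptyInterval
open Literature.Analysis.ODE Literature.Analysis.ValidatedNumerics Literature.Analysis.ValidatedNumerics.ITaylor

namespace Summit.Ventures.FusionMHD.Bench.SAlphaEnclosure

/-- Stage 17: the elementary HOE step test (derived program over `W_17` and `S_17`, inclusion (8.10) ⊆ `S_17`) AND the landing of its
end box in the hand-over box of stage 18 — ONE kernel evaluation. [cite: Moore1979, §8.1 eq. (8.10) with (8.13)] [cite: NedialkovJacksonCorliss1999, §5 Algorithm I] -/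
theorem ok17 : ((st17.toECert sAlphaCode cfg).check && boxLE (st17.toECert sAlphaCode cfg).endBox st18.init) = true := by
  decide +kernel

/-- Stage 17 passes the step test. [cite: Moore1979, §8.1 eq. (8.10) with (8.13)] -/
theorem ok17c : (st17.toECert sAlphaCode cfg).check = true := (Bool.and_eq_true_iff.1 ok17).1

/-- The end box of stage 17 lands in the hand-over box of stage 18. [cite: NedialkovJacksonCorliss1999, §5 Algorithm I] -/
theorem ok17b : boxLE (st17.toECert sAlphaCode cfg).endBox st18.init = true := (Bool.and_eq_true_iff.1 ok17).2

/-- Stage 18: the elementary HOE step test (derived program over `W_18` and `S_18`, inclusion (8.10) ⊆ `S_18`) AND the landing of its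
end box in the hand-over box of stage 19 — ONE kernel evaluation. [cite: Moore1979, §8.1 eq. (8.10) with (8.13)] [cite: NedialkovJacksonCorliss1999, §5 Algorithm I] -/
theorem ok18 : ((st18.toECert sAlphaCode cfg).check && boxLE (st18.toECert sAlphaCode cfg).endBox st19.init) = true := by
  decide +kernel

/-- Stage 18 passes the step test. [cite: Moore1979, §8.1 eq. (8.10) with (8.13)] -/
theorem ok18c : (st18.toECert sAlphaCode cfg).check = true := (Bool.and_eq_true_iff.1 ok18).1

/-- The end box of stage 18 lands in the hand-over box of stage 19. [cite: NedialkovJacksonCorliss1999, §5 Algorithm I] -/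
theorem ok18b : boxLE (st18.toECert sAlphaCode cfg).endBox st19.init = true := (Bool.and_eq_true_iff.1 ok18).2

/-- Stage 19: the elementary HOE step test (derived program over `W_19` and `S_19`, inclusion (8.10) ⊆ `S_19`) AND the landing of its
end box in the hand-over box of stage 20 — ONE kernel evaluation. [cite: Moore1979, §8.1 eq. (8.10) with (8.13)] [cite: NedialkovJacksonCorliss1999, §5 Algorithm I] -/
theorem ok19 : ((st19.toECert sAlphaCode cfg).check && boxLE (st19.toECert sAlphaCode cfg).endBox st20.init) = true := by
  decide +kernel

/-- Stage 19 passes the step test. [cite: Moore1979, §8.1 eq. (8.10) with (8.13)] -/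
theorem ok19c : (st19.toECert sAlphaCode cfg).check = true := (Bool.and_eq_true_iff.1 ok19).1

/-- The end box of stage 19 lands in the hand-over box of stage 20. [cite: NedialkovJacksonCorliss1999, §5 Algorithm I] -/
theorem ok19b : boxLE (st19.toECert sAlphaCode cfg).endBox st20.init = true := (Bool.and_eq_true_iff.1 ok19).2

/-- Stage 20: the elementary HOE step test (derived program over `W_20` and `S_20`, inclusion (8.10) ⊆ `S_20`) AND the landing of its
end box in the hand-over box of stage 21 — ONE kernel evaluation. [cite: Moore1979, §8.1 eq. (8.10) with (8.13)] [cite: NedialkovJacksonCorliss1999, §5 Algorithm I] -/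
theorem ok20 : ((st20.toECert sAlphaCode cfg).check && boxLE (st20.toECert sAlphaCode cfg).endBox st21.init) = true := by
  decide +kernel

/-- Stage 20 passes the step test. [cite: Moore1979, §8.1 eq. (8.10) with (8.13)] -/
theorem ok20c : (st20.toECert sAlphaCode cfg).check = true := (Bool.and_eq_true_iff.1 ok20).1

/-- The end box of stage 20 lands in the hand-over box of stage 21. [cite: NedialkovJacksonCorliss1999, §5 Algorithm I] -/
theorem ok20b : boxLE (st20.toECert sAlphaCode cfg).endBox st21.init = true := (Bool.and_eq_true_iff.1 ok20).2

/-- Stage 21: the elementary HOE step test (derived program over `W_21` and `S_21`, inclusion (8.10) ⊆ `S_21`) AND the landing of its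
end box in the hand-over box of stage 22 — ONE kernel evaluation. [cite: Moore1979, §8.1 eq. (8.10) with (8.13)] [cite: NedialkovJacksonCorliss1999, §5 Algorithm I] -/
theorem ok21 : ((st21.toECert sAlphaCode cfg).check && boxLE (st21.toECert sAlphaCode cfg).endBox st22.init) = true := by
  decide +kernel

/-- Stage 21 passes the step test. [cite: Moore1979, §8.1 eq. (8.10) with (8.13)] -/
theorem ok21c : (st21.toECert sAlphaCode cfg).check = true := (Bool.and_eq_true_iff.1 ok21).1

/-- The end box of stage 21 lands in the hand-over box of stage 22. [cite: NedialkovJacksonCorliss1999, §5 Algorithm I] -/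
theorem ok21b : boxLE (st21.toECert sAlphaCode cfg).endBox st22.init = true := (Bool.and_eq_true_iff.1 ok21).2

/-- Stage 22: the elementary HOE step test (derived program over `W_22` and `S_22`, inclusion (8.10) ⊆ `S_22`) AND the landing of its
end box in the hand-over box of stage 23 — ONE kernel evaluation. [cite: Moore1979, §8.1 eq. (8.10) with (8.13)] [cite: NedialkovJacksonCorliss1999, §5 Algorithm I] -/
theorem ok22 : ((st22.toECert sAlphaCode cfg).check && boxLE (st22.toECert sAlphaCode cfg).endBox st23.init) = true := by
  decide +kernel

/-- Stage 22 passes the step test. [cite: Moore1979, §8.1 eq. (8.10) with (8.13)] -/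
theorem ok22c : (st22.toECert sAlphaCode cfg).check = true := (Bool.and_eq_true_iff.1 ok22).1

/-- The end box of stage 22 lands in the hand-over box of stage 23. [cite: NedialkovJacksonCorliss1999, §5 Algorithm I] -/
theorem ok22b : boxLE (st22.toECert sAlphaCode cfg).endBox st23.init = true := (Bool.and_eq_true_iff.1 ok22).2

/-- Stage 23: the elementary HOE step test (derived program over `W_23` and `S_23`, inclusion (8.10) ⊆ `S_23`) AND the landing of its
end box in the hand-over box of stage 24 — ONE kernel evaluation. [cite: Moore1979, §8.1 eq. (8.10) with (8.13)] [cite: NedialkovJacksonCorliss1999, §5 Algorithm I] -/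
theorem ok23 : ((st23.toECert sAlphaCode cfg).check && boxLE (st23.toECert sAlphaCode cfg).endBox st24.init) = true := by
  decide +kernel

/-- Stage 23 passes the step test. [cite: Moore1979, §8.1 eq. (8.10) with (8.13)] -/
theorem ok23c : (st23.toECert sAlphaCode cfg).check = true := (Bool.and_eq_true_iff.1 ok23).1

/-- The end box of stage 23 lands in the hand-over box of stage 24. [cite: NedialkovJacksonCorliss1999, §5 Algorithm I] -/
theorem ok23b : boxLE (st23.toECert sAlphaCode cfg).endBox st24.init = true := (Bool.and_eq_true_iff.1 ok23).2

/-- Stage 24: the elementary HOE step test (derived program over `W_24` and `S_24`, inclusion (8.10) ⊆ `S_24`) AND the landing of its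
end box in the hand-over box of stage 25 — ONE kernel evaluation. [cite: Moore1979, §8.1 eq. (8.10) with (8.13)] [cite: NedialkovJacksonCorliss1999, §5 Algorithm I] -/
theorem ok24 : ((st24.toECert sAlphaCode cfg).check && boxLE (st24.toECert sAlphaCode cfg).endBox st25.init) = true := by
  decide +kernel

/-- Stage 24 passes the step test. [cite: Moore1979, §8.1 eq. (8.10) with (8.13)] -/
theorem ok24c : (st24.toECert sAlphaCode cfg).check = true := (Bool.and_eq_true_iff.1 ok24).1

/-- The end box of stage 24 lands in the hand-over box of stage 25. [cite: NedialkovJacksonCorliss1999, §5 Algorithm I] -/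
theorem ok24b : boxLE (st24.toECert sAlphaCode cfg).endBox st25.init = true := (Bool.and_eq_true_iff.1 ok24).2

/-- Stage 25: the elementary HOE step test (derived program over `W_25` and `S_25`, inclusion (8.10) ⊆ `S_25`) AND the landing of its
end box in the hand-over box of stage 26 — ONE kernel evaluation. [cite: Moore1979, §8.1 eq. (8.10) with (8.13)] [cite: NedialkovJacksonCorliss1999, §5 Algorithm I] -/
theorem ok25 : ((st25.toECert sAlphaCode cfg).check && boxLE (st25.toECert sAlphaCode cfg).endBox st26.init) = true := by
  decide +kernel

/-- Stage 25 passes the step test. [cite: Moore1979, §8.1 eq. (8.10) with (8.13)] -/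
theorem ok25c : (st25.toECert sAlphaCode cfg).check = true := (Bool.and_eq_true_iff.1 ok25).1

/-- The end box of stage 25 lands in the hand-over box of stage 26. [cite: NedialkovJacksonCorliss1999, §5 Algorithm I] -/
theorem ok25b : boxLE (st25.toECert sAlphaCode cfg).endBox st26.init = true := (Bool.and_eq_true_iff.1 ok25).2

/-- Stage 26: the elementary HOE step test (derived program over `W_26` and `S_26`, inclusion (8.10) ⊆ `S_26`) AND the landing of its
end box in the hand-over box of stage 27 — ONE kernel evaluation. [cite: Moore1979, §8.1 eq. (8.10) with (8.13)] [cite: NedialkovJacksonCorliss1999, §5 Algorithm I] -/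
theorem ok26 : ((st26.toECert sAlphaCode cfg).check && boxLE (st26.toECert sAlphaCode cfg).endBox st27.init) = true := by
  decide +kernel

/-- Stage 26 passes the step test. [cite: Moore1979, §8.1 eq. (8.10) with (8.13)] -/
theorem ok26c : (st26.toECert sAlphaCode cfg).check = true := (Bool.and_eq_true_iff.1 ok26).1

/-- The end box of stage 26 lands in the hand-over box of stage 27. [cite: NedialkovJacksonCorliss1999, §5 Algorithm I] -/
theorem ok26b : boxLE (st26.toECert sAlphaCode cfg).endBox st27.init = true := (Bool.and_eq_true_iff.1 ok26).2

/-- Stage 27: the elementary HOE step test (derived program over `W_27` and `S_27`, inclusion (8.10) ⊆ `S_27`) AND the landing of its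
end box in the hand-over box of stage 28 — ONE kernel evaluation. [cite: Moore1979, §8.1 eq. (8.10) with (8.13)] [cite: NedialkovJacksonCorliss1999, §5 Algorithm I] -/
theorem ok27 : ((st27.toECert sAlphaCode cfg).check && boxLE (st27.toECert sAlphaCode cfg).endBox st28.init) = true := by
  decide +kernel

/-- Stage 27 passes the step test. [cite: Moore1979, §8.1 eq. (8.10) with (8.13)] -/
theorem ok27c : (st27.toECert sAlphaCode cfg).check = true := (Bool.and_eq_true_iff.1 ok27).1

/-- The end box of stage 27 lands in the hand-over box of stage 28. [cite: NedialkovJacksonCorliss1999, §5 Algorithm I] -/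
theorem ok27b : boxLE (st27.toECert sAlphaCode cfg).endBox st28.init = true := (Bool.and_eq_true_iff.1 ok27).2

/-- Stage 28: the elementary HOE step test (derived program over `W_28` and `S_28`, inclusion (8.10) ⊆ `S_28`) AND the landing of its
end box in the hand-over box of stage 29 — ONE kernel evaluation. [cite: Moore1979, §8.1 eq. (8.10) with (8.13)] [cite: NedialkovJacksonCorliss1999, §5 Algorithm I] -/
theorem ok28 : ((st28.toECert sAlphaCode cfg).check && boxLE (st28.toECert sAlphaCode cfg).endBox st29.init) = true := by
  decide +kernel

/-- Stage 28 passes the step test. [cite: Moore1979, §8.1 eq. (8.10) with (8.13)] -/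
theorem ok28c : (st28.toECert sAlphaCode cfg).check = true := (Bool.and_eq_true_iff.1 ok28).1

/-- The end box of stage 28 lands in the hand-over box of stage 29. [cite: NedialkovJacksonCorliss1999, §5 Algorithm I] -/
theorem ok28b : boxLE (st28.toECert sAlphaCode cfg).endBox st29.init = true := (Bool.and_eq_true_iff.1 ok28).2

/-- Stage 29: the elementary HOE step test (derived program over `W_29` and `S_29`, inclusion (8.10) ⊆ `S_29`) AND the landing of its
end box in the hand-over box of stage 30 — ONE kernel evaluation. [cite: Moore1979, §8.1 eq. (8.10) with (8.13)] [cite: NedialkovJacksonCorliss1999, §5 Algorithm I] -/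
theorem ok29 : ((st29.toECert sAlphaCode cfg).check && boxLE (st29.toECert sAlphaCode cfg).endBox st30.init) = true := by
  decide +kernel

/-- Stage 29 passes the step test. [cite: Moore1979, §8.1 eq. (8.10) with (8.13)] -/
theorem ok29c : (st29.toECert sAlphaCode cfg).check = true := (Bool.and_eq_true_iff.1 ok29).1

/-- The end box of stage 29 lands in the hand-over box of stage 30. [cite: NedialkovJacksonCorliss1999, §5 Algorithm I] -/
theorem ok29b : boxLE (st29.toECert sAlphaCode cfg).endBox st30.init = true := (Bool.and_eq_true_iff.1 ok29).2

/-- Stage 30: the elementary HOE step test (derived program over `W_30` and `S_30`, inclusion (8.10) ⊆ `S_30`) AND the landing of its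
end box in the hand-over box of stage 31 — ONE kernel evaluation. [cite: Moore1979, §8.1 eq. (8.10) with (8.13)] [cite: NedialkovJacksonCorliss1999, §5 Algorithm I] -/
theorem ok30 : ((st30.toECert sAlphaCode cfg).check && boxLE (st30.toECert sAlphaCode cfg).endBox st31.init) = true := by
  decide +kernel

/-- Stage 30 passes the step test. [cite: Moore1979, §8.1 eq. (8.10) with (8.13)] -/
theorem ok30c : (st30.toECert sAlphaCode cfg).check = true := (Bool.and_eq_true_iff.1 ok30).1

/-- The end box of stage 30 lands in the hand-over box of stage 31. [cite: NedialkovJacksonCorliss1999, §5 Algorithm I] -/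
theorem ok30b : boxLE (st30.toECert sAlphaCode cfg).endBox st31.init = true := (Bool.and_eq_true_iff.1 ok30).2

/-- Stage 31: the elementary HOE step test (derived program over `W_31` and `S_31`, inclusion (8.10) ⊆ `S_31`) AND the landing of its
end box in the hand-over box of stage 32 — ONE kernel evaluation. [cite: Moore1979, §8.1 eq. (8.10) with (8.13)] [cite: NedialkovJacksonCorliss1999, §5 Algorithm I] -/
theorem ok31 : ((st31.toECert sAlphaCode cfg).check && boxLE (st31.toECert sAlphaCode cfg).endBox st32.init) = true := by
  decide +kernel

/-- Stage 31 passes the step test. [cite: Moore1979, §8.1 eq. (8.10) with (8.13)] -/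
theorem ok31c : (st31.toECert sAlphaCode cfg).check = true := (Bool.and_eq_true_iff.1 ok31).1

/-- The end box of stage 31 lands in the hand-over box of stage 32. [cite: NedialkovJacksonCorliss1999, §5 Algorithm I] -/
theorem ok31b : boxLE (st31.toECert sAlphaCode cfg).endBox st32.init = true := (Bool.and_eq_true_iff.1 ok31).2

/-- Stage 32: the elementary HOE step test (derived program over `W_32` and `S_32`, inclusion (8.10) ⊆ `S_32`) AND the landing of its
end box in the hand-over box of stage 33 — ONE kernel evaluation. [cite: Moore1979, §8.1 eq. (8.10) with (8.13)] [cite: NedialkovJacksonCorliss1999, §5 Algorithm I] -/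
theorem ok32 : ((st32.toECert sAlphaCode cfg).check && boxLE (st32.toECert sAlphaCode cfg).endBox st33.init) = true := by
  decide +kernel

/-- Stage 32 passes the step test. [cite: Moore1979, §8.1 eq. (8.10) with (8.13)] -/
theorem ok32c : (st32.toECert sAlphaCode cfg).check = true := (Bool.and_eq_true_iff.1 ok32).1

/-- The end box of stage 32 lands in the hand-over box of stage 33. [cite: NedialkovJacksonCorliss1999, §5 Algorithm I] -/
theorem ok32b : boxLE (st32.toECert sAlphaCode cfg).endBox st33.init = true := (Bool.and_eq_true_iff.1 ok32).2

/-- Stage 33: the elementary HOE step test (derived program over `W_33` and `S_33`, inclusion (8.10) ⊆ `S_33`) AND the landing of its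
end box in the hand-over box of stage 34 — ONE kernel evaluation. [cite: Moore1979, §8.1 eq. (8.10) with (8.13)] [cite: NedialkovJacksonCorliss1999, §5 Algorithm I] -/
theorem ok33 : ((st33.toECert sAlphaCode cfg).check && boxLE (st33.toECert sAlphaCode cfg).endBox st34.init) = true := by
  decide +kernel

/-- Stage 33 passes the step test. [cite: Moore1979, §8.1 eq. (8.10) with (8.13)] -/
theorem ok33c : (st33.toECert sAlphaCode cfg).check = true := (Bool.and_eq_true_iff.1 ok33).1

/-- The end box of stage 33 lands in the hand-over box of stage 34. [cite: NedialkovJacksonCorliss1999, §5 Algorithm I] -/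
theorem ok33b : boxLE (st33.toECert sAlphaCode cfg).endBox st34.init = true := (Bool.and_eq_true_iff.1 ok33).2

end Summit.Ventures.FusionMHD.Bench.SAlphaEnclosure
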